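import Summits.BirchSwinnertonDyer.BirchSwinnertonDyer.Theorems.AlignedTransportAtTwoMainConjectureOfRankZeroBSDAtTwoCubicDoorsDeadSubcellClassNumberE
import Summits.BirchSwinnertonDyer.Rank1Residual.X5.TwoAdicInstancesToolkitB
import Literature.NumberTheory.CubicFields.CubicFieldDiscriminant1607ClassNumber
import HarnessLib

/-!
# Route `AlignedTransportAtTwo`, crux C2 `MainConjectureOfRankZeroBSDAtTwo` (stmt-BirchSwinnertonDyer-22298):
# THE SPLIT-STRATUM SEED `[1, 0, 1, −153, −777]` (`N = 8035`): kernel-decided invariants, `Δ_min = -25109375 = −1607·125² ≡ 1 (mod 8)` (ON the Kilford stratum),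
# and its cubic `2`-torsion field `ℚ(β)` = the cubic field of discriminant `−1607` (`h = 1`, `2` totally split — Dedekind-type, no power integral basis)

HONEST FRAMING (cell `bsd-f1-sign2`, WIDTH-5 attached prover seat `bsd-line-att-p4` gen 46 on line `birth` of the lead `bsd-line-att-p2`;
`--supports` stmt-BirchSwinnertonDyer-22298, closes nothing; BSD is NOT proved by any of this; the crux C2, its verdict «blocked-on
`Rank1Residual.GreenbergMuConjectureIrreducible`» and every registered stub are untouched).  THEOREMS ONLY (no `def`, no named fact, no instance, no `sorry`);
the curve is written LITERALLY; no Cremona label is asserted (names use `n<conductor>`).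

WHAT.  The W-data row (template: att-p4 g44 `…CubicDoorsDeadSubcellClassNumberK`, this seat's `…CubicSplitStratumSeedN17671`) for a seed of the SPLIT stratum
`Δ_min ≡ 1 (mod 8)` of the cell's census (att-p3 g53 `CENSUS-SPLITDOOR-att-p3-g53.md`, `r = rank₂ Cl(ℚ(β,√2)) = 1`).  On this stratum `2` splits completely in
the cubic `2`-torsion field `ℚ(β)` (Dedekind's common index divisor; NO power integral basis): this seat's Literature files `CubicFieldDiscriminant1607{,ClassNumber}`
present `𝓞 = ℤ ⊕ ℤθ ⊕ ℤδ` with `θ³ + 8θ² + 3θ + 4 = 0`, `δ = (θ² + θ)/2` (index exactly `2`, `IntegralBasisIndexTwo`) and prove `h = 1`.  Here: `Δ = -25109375`, `c₄ = 7321`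
(coprime ⟹ globally minimal), `#Ẽ(𝔽₂) = 2` (good ORDINARY at `2`), `b₂,b₄,b₆ = 1, -305, -3107`, `E[2]` irreducible (the `u`-cubic has no root mod `3`), `Δ_min ≡ 1 (mod 8)`,
`Δ < 0`, ★ `aeval_theta_n8035` (`θ = (1/125)β² − (203/500)β − 1757/500` is a root of `X³ + 8θ² + 3θ + 4`), `finrank`, `discr = −1607`, ★ `classNumber_cubicField_n8035_eq_one`,
★ `not_two_dvd_classNumber_cubicField_n8035`.  Consumed by this seat's layer-two relation row `…CubicSplitStratumLayerTwoRelationRowN8035`.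
Nothing is asserted about `μ₂` or `MC₂` here.

References: [LMFDB] number field 3.1.1607.1, elliptic curves of conductor 8035; [Marcus2018] Ch. 3 Ex. 21, Ch. 5 Thm. 37; [SilvermanAEC2009] III.1, III.2.3, VII.1,
VII.5; [Serre1973] II §3.3; tree: att-p4 g44 `…CubicDoorsDeadSubcellClassNumberK` (template), att-p5 g26 `…CubicKilfordPrimes`, this seat's `CubicFieldDiscriminant1607`.
-/

set_option linter.dupNamespace false
set_option autoImplicit false

noncomputable section

open scoped Classical NumberField nonZeroDivisors IntermediateField

namespace Summit.BirchSwinnertonDyer.BirchSwinnertonDyer.Theorems.AlignedTransportAtTwoCubicSplitStratumSeedN8035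

open NumberField IsDedekindDomain Polynomial WeierstrassCurve IntermediateField CongruenceSubgroup Module
  Literature.NumberTheory.IwasawaTheory Literature.NumberTheory.GaloisRepresentations
  Literature.NumberTheory.EllipticCurves Literature.NumberTheory.EllipticCurves.Greenberg1999
  Literature.NumberTheory.EllipticCurves.ModularForms Literature.NumberTheory.EllipticCurves.Rank1Residual
  Literature.NumberTheory.EllipticCurves.Module
  Literature.NumberTheory.NumberFields Literature.NumberTheory.CubicFields
  Summit.BirchSwinnertonDyer.Rank1Residual Summit.BirchSwinnertonDyer.Rank1Residual.X1.MuLambda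
  Summit.BirchSwinnertonDyer.Rank1Residual.X5 Summit.BirchSwinnertonDyer.Rank1Residual.X5.O1
  Summit.BirchSwinnertonDyer.Rank1Residual.X5.Instances Summit.BirchSwinnertonDyer.Rank1Residual.F1Sign2
  Summit.BirchSwinnertonDyer.BirchSwinnertonDyer.Theorems.Rank1ResidualX1Defs
  Summit.BirchSwinnertonDyer.BirchSwinnertonDyer.Theses.AlignedTransportAtTwo
  Summit.BirchSwinnertonDyer.BirchSwinnertonDyer.Theorems.AlignedTransportAtTwoKilfordStratumShared
open Summit.BirchSwinnertonDyer.BirchSwinnertonDyer.Theorems.AlignedTransportAtTwoCubicKilfordPrimes (psi_gen_eq_zero)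

/-! ## §0 The curve `⟨1, 0, 1, -153, -777⟩` of conductor `8035` (rank 0) — kernel-decided invariants and its cubic field -/

/-- `Δ = -25109375 = −1607·125²`. [cite: SilvermanAEC2009, III.1] -/
theorem M8035_Δ : (⟨1, 0, 1, -153, -777⟩ : WeierstrassCurve ℤ).Δ = -25109375 := by decide

/-- `c₄ = 7321`. [cite: SilvermanAEC2009, III.1] -/
theorem M8035_c₄ : (⟨1, 0, 1, -153, -777⟩ : WeierstrassCurve ℤ).c₄ = 7321 := by decide

/-- `⟨1, 0, 1, -153, -777⟩` is an elliptic curve (`Δ = -25109375 ≠ 0`). [cite: SilvermanAEC2009, III.1] -/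
theorem isElliptic_n8035 : ((⟨1, 0, 1, -153, -777⟩ : WeierstrassCurve ℤ).baseChange ℚ).IsElliptic := by
  rw [WeierstrassCurve.isElliptic_iff, baseChange_int_Δ, M8035_Δ]; norm_num

/-- The model `⟨1, 0, 1, -153, -777⟩` is globally minimal (`gcd(Δ, c₄) = 1`). [cite: SilvermanAEC2009, VII.1 Remark 1.1] -/
theorem isGloballyMinimal_n8035 : ((⟨1, 0, 1, -153, -777⟩ : WeierstrassCurve ℤ).baseChange ℚ).IsGloballyMinimal :=
  isGloballyMinimal_baseChange_int_of_gcd_eq_one 1 0 1 (-153) (-777) (by decide)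

/-- `⟨1, 0, 1, -153, -777⟩ mod 2` is `[1, 0, 1, 1, 1]`. [folklore] -/
theorem M8035_mod_two : (⟨1, 0, 1, -153, -777⟩ : WeierstrassCurve ℤ).map (Int.castRingHom (ZMod 2)) = ⟨1, 0, 1, 1, 1⟩ := by
  ext <;> decide

/-- `#Ẽ(𝔽₂) = 2` for `⟨1, 0, 1, -153, -777⟩` (`a₂ = 3 − 2 = 1`, odd). [cite: SilvermanAEC2009, V.2] -/
theorem M8035_card_two :
    Nat.card ((⟨1, 0, 1, -153, -777⟩ : WeierstrassCurve ℤ).map (Int.castRingHom (ZMod 2))).toAffine.Point = 2 := by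
  rw [M8035_mod_two, natCard_point_eq_one_add_card _ (by decide)]; decide

/-- **`⟨1, 0, 1, -153, -777⟩` has good ORDINARY reduction at `2`** (`2 ∤ Δ`, `#Ẽ(𝔽₂) = 2`, `a₂` odd). [cite: SilvermanAEC2009, VII.5 Prop. 5.1 (a)] -/
theorem goodOrd_two_n8035 [((⟨1, 0, 1, -153, -777⟩ : WeierstrassCurve ℤ).baseChange ℚ).IsElliptic] [((⟨1, 0, 1, -153, -777⟩ : WeierstrassCurve ℤ).baseChange ℚ).IsGloballyMinimal] : GoodOrd ((⟨1, 0, 1, -153, -777⟩ : WeierstrassCurve ℤ).baseChange ℚ) 2 :=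
  Instances.goodOrd_two_baseChange_int_of_card_two _ (by rw [M8035_Δ]; decide) M8035_card_two

/-- The coefficients of `⟨1, 0, 1, -153, -777⟩ / ℚ` (unfolded). [cite: SilvermanAEC2009, III.1] -/
theorem c8035_eq : ((⟨1, 0, 1, -153, -777⟩ : WeierstrassCurve ℤ).baseChange ℚ) = ⟨1, 0, 1, -153, -777⟩ := by
  rw [baseChange_int_eq]; norm_num

/-- `b₂, b₄, b₆` of `⟨1, 0, 1, -153, -777⟩`: `1, -305, -3107`. [cite: SilvermanAEC2009, III.1] -/
theorem c8035_b : ((⟨1, 0, 1, -153, -777⟩ : WeierstrassCurve ℤ).baseChange ℚ).b₂ = ((1 : ℤ) : ℚ) ∧ ((⟨1, 0, 1, -153, -777⟩ : WeierstrassCurve ℤ).baseChange ℚ).b₄ = ((-305 : ℤ) : ℚ) ∧ ((⟨1, 0, 1, -153, -777⟩ : WeierstrassCurve ℤ).baseChange ℚ).b₆ = ((-3107 : ℤ) : ℚ) := by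
  rw [c8035_eq]; simp only [WeierstrassCurve.b₂, WeierstrassCurve.b₄, WeierstrassCurve.b₆]; norm_num

/-- **`E[2]` irreducible for `⟨1, 0, 1, -153, -777⟩`**: the monic `u`-cubic `u³ + 1u² + -2440u + -49712` has no root modulo `3`.
[cite: SilvermanAEC2009, III.2.3 (b)] -/
theorem irr_two_n8035 [((⟨1, 0, 1, -153, -777⟩ : WeierstrassCurve ℤ).baseChange ℚ).IsElliptic] : Irr ((⟨1, 0, 1, -153, -777⟩ : WeierstrassCurve ℤ).baseChange ℚ) 2 :=
  irr_two_of_forall_cubic_ne _ c8035_b.1 c8035_b.2.1 c8035_b.2.2 (ℓ := 3) (by decide)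

/-- No rational `2`-torsion abscissa on `⟨1, 0, 1, -153, -777⟩` (the route's `ht` binder). [cite: SilvermanAEC2009, III.2.3 (b)] -/
theorem not_hasRationalTwoTorsionX_n8035 [((⟨1, 0, 1, -153, -777⟩ : WeierstrassCurve ℤ).baseChange ℚ).IsElliptic] : ∀ x : ℚ, ¬ HasRationalTwoTorsionX ((⟨1, 0, 1, -153, -777⟩ : WeierstrassCurve ℤ).baseChange ℚ) x := by
  intro x hx
  exact (O1.irr_two_iff_not_exists_addOrderOf_eq_two _).mp irr_two_n8035 (exists_point_addOrderOf_eq_two hx)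

/-- `Δ_min = -25109375`. [cite: SilvermanAEC2009, VII.1] -/
theorem minimalDiscriminantInt_n8035 [((⟨1, 0, 1, -153, -777⟩ : WeierstrassCurve ℤ).baseChange ℚ).IsGloballyMinimal] : ((⟨1, 0, 1, -153, -777⟩ : WeierstrassCurve ℤ).baseChange ℚ).minimalDiscriminantInt = -25109375 := by
  rw [Instances.minimalDiscriminantInt_baseChange_int, M8035_Δ]

/-- `Δ_min = -25109375 ≡ 1 (mod 8)`: ON the Kilford (split) stratum — `2` splits completely in `ℚ(β)`. [cite: Serre1973, Ch. II §3.3 Thm. 4] -/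
theorem minimalDiscriminantInt_emod_eight_n8035 [((⟨1, 0, 1, -153, -777⟩ : WeierstrassCurve ℤ).baseChange ℚ).IsGloballyMinimal] : ((⟨1, 0, 1, -153, -777⟩ : WeierstrassCurve ℤ).baseChange ℚ).minimalDiscriminantInt % 8 = 1 := by
  rw [minimalDiscriminantInt_n8035]; decide

/-- **`⟨1, 0, 1, -153, -777⟩` is ON the Kilford stratum.** [cite: Serre1973, Ch. II §3.3 Thm. 4] -/
theorem onKilfordStratumAtTwo_n8035 [((⟨1, 0, 1, -153, -777⟩ : WeierstrassCurve ℤ).baseChange ℚ).IsElliptic] [((⟨1, 0, 1, -153, -777⟩ : WeierstrassCurve ℤ).baseChange ℚ).IsGloballyMinimal] : OnKilfordStratumAtTwo ((⟨1, 0, 1, -153, -777⟩ : WeierstrassCurve ℤ).baseChange ℚ) :=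
  (onKilfordStratumAtTwo_iff_minimalDiscriminantInt_emod_eight _ goodOrd_two_n8035).mpr minimalDiscriminantInt_emod_eight_n8035

/-- `Δ < 0` (`ℚ(β)` is a complex cubic field). [cite: SilvermanAEC2009, III.1] -/
theorem Δ_n8035_neg : ((⟨1, 0, 1, -153, -777⟩ : WeierstrassCurve ℤ).baseChange ℚ).Δ < 0 := by
  rw [baseChange_int_Δ, M8035_Δ]; norm_num

/-- **`θ := (1/125)g² − (203/500)g − 1757/500 ∈ ℚ(β)` (`g = β`) is a root of `f = X³ + 8X² + 3X + 4`** (one `linear_combination` against `ψ_W(β) = 4β³ + 1β² + 2·(-305)β + (-3107) = 0`;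
the multiplier is the exact quotient in `ℚ[β]`). [cite: LMFDB, number field 3.1.1607.1 (degree 3, discriminant −1607)] [cite: SilvermanAEC2009, III.1] -/
theorem aeval_theta_n8035 {β : AlgebraicClosure ℚ} (hβ : aeval β ((⟨1, 0, 1, -153, -777⟩ : WeierstrassCurve ℤ).baseChange ℚ).twoTorsionPolynomial.toPoly = 0) :
    aeval ((1 / 125 : ↥(IntermediateField.adjoin ℚ ({β} : Set (AlgebraicClosure ℚ)))) * (AdjoinSimple.gen ℚ β : ↥(IntermediateField.adjoin ℚ ({β} : Set (AlgebraicClosure ℚ)))) ^ 2 + (-203 / 500 : ↥(IntermediateField.adjoin ℚ ({β} : Set (AlgebraicClosure ℚ)))) * (AdjoinSimple.gen ℚ β : ↥(IntermediateField.adjoin ℚ ({β} : Set (AlgebraicClosure ℚ)))) + (-1757 / 500 : ↥(IntermediateField.adjoin ℚ ({β} : Set (AlgebraicClosure ℚ))))) (MonicCubic.poly 8 3 4) = 0 := by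
  have hψ := psi_gen_eq_zero ((⟨1, 0, 1, -153, -777⟩ : WeierstrassCurve ℤ).baseChange ℚ) hβ
  rw [c8035_b.1, c8035_b.2.1, c8035_b.2.2] at hψ
  set g : ↥(IntermediateField.adjoin ℚ ({β} : Set (AlgebraicClosure ℚ))) := AdjoinSimple.gen ℚ β with hg
  simp only [MonicCubic.poly, map_add, map_mul, map_pow, aeval_X, eq_intCast, map_intCast]
  push_cast at hψ ⊢
  linear_combination ((-1965401 / 125000000 : ↥(IntermediateField.adjoin ℚ ({β} : Set (AlgebraicClosure ℚ)))) * g ^ 0 + (121593 / 125000000 : ↥(IntermediateField.adjoin ℚ ({β} : Set (AlgebraicClosure ℚ)))) * g ^ 1 + (-61 / 3125000 : ↥(IntermediateField.adjoin ℚ ({β} : Set (AlgebraicClosure ℚ)))) * g ^ 2 + (1 / 7812500 : ↥(IntermediateField.adjoin ℚ ({β} : Set (AlgebraicClosure ℚ)))) * g ^ 3) * hψ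

/-- `[ℚ(β) : ℚ] = 3`. [cite: SilvermanAEC2009, III.2.3 (b)] -/
theorem finrank_cubicField_n8035 {β : AlgebraicClosure ℚ} (hβ : aeval β ((⟨1, 0, 1, -153, -777⟩ : WeierstrassCurve ℤ).baseChange ℚ).twoTorsionPolynomial.toPoly = 0) :
    finrank ℚ ↥(IntermediateField.adjoin ℚ ({β} : Set (AlgebraicClosure ℚ))) = 3 := by
  haveI := isElliptic_n8035
  exact AddKatoTwo.finrank_adjoin_root_twoTorsionPolynomial_eq_three _
    (AlignedTransportAtTwoSeed.irr_two_of_forall_not_hasRationalTwoTorsionX _ not_hasRationalTwoTorsionX_n8035) hβ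

/-- **`d_{ℚ(β)} = −1607`**. [cite: LMFDB, number field 3.1.1607.1 (discriminant −1607)] -/
theorem discr_cubicField_n8035 {β : AlgebraicClosure ℚ} (hβ : aeval β ((⟨1, 0, 1, -153, -777⟩ : WeierstrassCurve ℤ).baseChange ℚ).twoTorsionPolynomial.toPoly = 0) :
    (haveI : FiniteDimensional ℚ ↥(IntermediateField.adjoin ℚ ({β} : Set (AlgebraicClosure ℚ))) := IntermediateField.adjoin.finiteDimensional ((AlgebraicClosure.isAlgebraic ℚ).isAlgebraic β).isIntegral;
      haveI : NumberField ↥(IntermediateField.adjoin ℚ ({β} : Set (AlgebraicClosure ℚ))) := NumberField.mk;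
      NumberField.discr ↥(IntermediateField.adjoin ℚ ({β} : Set (AlgebraicClosure ℚ))) = -1607) := by
  haveI : FiniteDimensional ℚ ↥(IntermediateField.adjoin ℚ ({β} : Set (AlgebraicClosure ℚ))) := IntermediateField.adjoin.finiteDimensional ((AlgebraicClosure.isAlgebraic ℚ).isAlgebraic β).isIntegral
  haveI : NumberField ↥(IntermediateField.adjoin ℚ ({β} : Set (AlgebraicClosure ℚ))) := NumberField.mk
  exact CubicDisc1607.discr_eq (finrank_cubicField_n8035 hβ) (aeval_theta_n8035 hβ)

/-- ★ **`h(ℚ(β)) = 1`** (`ℚ(β)` = the cubic field of discriminant `−1607`, this seat's `CubicDisc1607.classNumber_eq_one`). [cite: LMFDB, number field 3.1.1607.1 (class number 1)] -/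
theorem classNumber_cubicField_n8035_eq_one {β : AlgebraicClosure ℚ} (hβ : aeval β ((⟨1, 0, 1, -153, -777⟩ : WeierstrassCurve ℤ).baseChange ℚ).twoTorsionPolynomial.toPoly = 0) :
    (haveI : FiniteDimensional ℚ ↥(IntermediateField.adjoin ℚ ({β} : Set (AlgebraicClosure ℚ))) := IntermediateField.adjoin.finiteDimensional ((AlgebraicClosure.isAlgebraic ℚ).isAlgebraic β).isIntegral;
      haveI : NumberField ↥(IntermediateField.adjoin ℚ ({β} : Set (AlgebraicClosure ℚ))) := NumberField.mk;
      classNumber ↥(IntermediateField.adjoin ℚ ({β} : Set (AlgebraicClosure ℚ))) = 1) := by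
  haveI : FiniteDimensional ℚ ↥(IntermediateField.adjoin ℚ ({β} : Set (AlgebraicClosure ℚ))) := IntermediateField.adjoin.finiteDimensional ((AlgebraicClosure.isAlgebraic ℚ).isAlgebraic β).isIntegral
  haveI : NumberField ↥(IntermediateField.adjoin ℚ ({β} : Set (AlgebraicClosure ℚ))) := NumberField.mk
  exact CubicDisc1607.classNumber_eq_one (finrank_cubicField_n8035 hβ) (aeval_theta_n8035 hβ)

/-- ★ **`2 ∤ h(ℚ(β))`** (the doors' datum verbatim). [cite: LMFDB, number field 3.1.1607.1 (class number 1)] -/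
theorem not_two_dvd_classNumber_cubicField_n8035 {β : AlgebraicClosure ℚ} (hβ : aeval β ((⟨1, 0, 1, -153, -777⟩ : WeierstrassCurve ℤ).baseChange ℚ).twoTorsionPolynomial.toPoly = 0) :
    (haveI : FiniteDimensional ℚ ↥(IntermediateField.adjoin ℚ ({β} : Set (AlgebraicClosure ℚ))) := IntermediateField.adjoin.finiteDimensional ((AlgebraicClosure.isAlgebraic ℚ).isAlgebraic β).isIntegral;
      haveI : NumberField ↥(IntermediateField.adjoin ℚ ({β} : Set (AlgebraicClosure ℚ))) := NumberField.mk;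
      ¬ 2 ∣ classNumber ↥(IntermediateField.adjoin ℚ ({β} : Set (AlgebraicClosure ℚ)))) := by
  haveI : FiniteDimensional ℚ ↥(IntermediateField.adjoin ℚ ({β} : Set (AlgebraicClosure ℚ))) := IntermediateField.adjoin.finiteDimensional ((AlgebraicClosure.isAlgebraic ℚ).isAlgebraic β).isIntegral
  haveI : NumberField ↥(IntermediateField.adjoin ℚ ({β} : Set (AlgebraicClosure ℚ))) := NumberField.mk
  exact CubicDisc1607.not_two_dvd_classNumber (finrank_cubicField_n8035 hβ) (aeval_theta_n8035 hβ)

end Summit.BirchSwinnertonDyer.BirchSwinnertonDyer.Theorems.AlignedTransportAtTwoCubicSplitStratumSeedN8035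

end
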